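import Summits.HodgeConjecture.HodgeCM.Model.WeilCentralCoinvariants_2
import Literature.NumberTheory.Weil1964.AdelicMetaplecticFinRepConj
import Literature.NumberTheory.GelbartRogawski1991.DoubledUnitaryDiagonalEmbedding
import HarnessLib

/-!
# The mirror line `W⁻ = (W, −⟨·,·⟩)`: its finite Weil representation is the conjugate one (Track T, (T4b″)) — HC_CM is NOT proved

(T4b″) of the re-key plan's Track T (own-crow PROPOSAL T; ω-side spec mc-theta-3 2026-08-23T22:19:25Z; split with adapt-2,
`HOME/INBOX` 2026-08-23T22:44:43Z ∕ prove-6 22:5xZ): RECOGNITION of the conjugate finite Weil representation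
`C_f (ω_f ∘ s_pair) C_f` of the dual pair `U(J_V) × U(J_W)` (✔ `Weil1964.AdelicMetaplecticFinRepConj`, ✔ `D2Bridge/WeilCoinvConj`)
as the finite Weil representation `ω_f ∘ s̄_pair` of the HONEST mirror datum `(T_W ↦ −T_W, J_W ↦ −J_W, s ↦ s̄)`.

* §1 casts along an equality of Gram matrices: `mpCongr (h : T = T') : Mp_ψ(W_T)ᶜᵒⁿᵗ ≃* Mp_ψ(W_{T'})ᶜᵒⁿᵗ` with the SAME
  operators, projections and `Θ`-fixing (all by `subst`).
* §2 the sign identities: `U(−J) = U(J)` for the adelic ∕ finite-adelic unitary groups and the big group of the pair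
  (✔ `unitaryGroupOfForm_neg'`), `adelicGram e T_V (−T_W) = −adelicGram e T_V T_W`, and the Kronecker currency.
* §3 the MIRROR SPLITTING `s̄ := mpCongr ∘ (·)ᶜ ∘ s ∘ (U(J_V ⊗ (−J_W)) = U(J_V ⊗ J_W))` of a pair splitting `s` and its
  projection (first half of `IsCompatible s̄`; the rational half is adapt-2's).
* (sequel file `WeilFinRepMirrorOperator.lean`, §4) **THE OPERATOR LAW** `ω(pairSmall₁ s̄ (ι k, ι ū)) Ψ = C (ω(pairSmall₁ s (ι k, ι u)) (C Ψ))` and, by adapt-2's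
  ✔ `AdapterWeil.finRepMp_eq_conj_of_omega_eq`, **`finRepMp (s̄-pair) (k, ū) Φ = C_f (finPairRep hs (k, u) (C_f Φ))`** — for ANY
  compatibility witness of `s̄` this is `finPairRep hs̄ (k, ū) = C_f finPairRep hs (k, u) C_f` (`finPairRep_mirror`), i.e. the
  binders `hTW ∕ hTV` of prove-7's socket ✔ `Rekey/Transport/TwistedCoinvSemilinear.exists_Ω_semilinearEquiv` with `T := C_f`,
  `ψ := ū`.

NOT here: the rational half of `IsCompatible s̄` (adapt-2: `conj r_T(γ) = r_{−T}(γ♭)`), the `SplitLine.mirror` packaging (needs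
that half), CM types ∕ characters ((T4d), pin-3).  HELD; HC_CM is NOT proved.

References: J.-S. Li, J. reine angew. Math. 428 (1992) p. 181 (`ω*` = `ω_{ψ̄}`); C. Mœglin, M.-F. Vignéras, J.-L. Waldspurger,
LNM 1291 (1987) Chap. 2 II.1; S. Kudla, Israel J. Math. 87 (1994) §1–§2; Y. Liu, Camb. J. Math. 9 (2021) App. D Lemma D.1 (2).
-/

set_option autoImplicit false

noncomputable section

open scoped TensorProduct ComplexConjugate Kronecker

/-! ## §1 Casts along an equality of Gram matrices -/

namespace Literature.NumberTheory.Weil1964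

open Literature.RepresentationTheory.HeisenbergGroup Literature.NumberTheory.Automorphic NumberField
  NumberField.mixedEmbedding IsDedekindDomain

section MpCongr

variable {F : Type} [Field F] [NumberField F] {ι : Type} [Fintype ι] [DecidableEq ι]
  {T T' : Matrix ι ι (AdeleRing (𝓞 F) F)}

/-- **`Mp_ψ(W_T)ᶜᵒⁿᵗ ≃* Mp_ψ(W_{T'})ᶜᵒⁿᵗ` along `T = T'`** (the identity, re-typed). [cite: MoeglinVignerasWaldspurger1987, Chap. 2 II.1] -/
def mpCongr (h : T = T') : adelicMpCont F ι T ≃* adelicMpCont F ι T' := h ▸ MulEquiv.refl _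

/-- same operator: `ω_{T'}(mpCongr h p) = ω_T(p)`. [cite: MoeglinVignerasWaldspurger1987, Chap. 2 II.1] -/
theorem adelicMpCont.omega_mpCongr_apply (h : T = T') (p : adelicMpCont F ι T) (Ψ : piSchwartzBruhat F ι) :
    adelicMpCont.omega F ι T' (mpCongr h p) Ψ = adelicMpCont.omega F ι T p Ψ := by
  subst h; rfl

/-- same projection in `GL(W_𝔸)`. [cite: MoeglinVignerasWaldspurger1987, Chap. 2 II.1 (B)] -/
theorem adelicMpCont.coe_proj_mpCongr (h : T = T') (p : adelicMpCont F ι T) :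
    ((adelicMpCont.proj F ι T' (mpCongr h p) : symplecticGroup (polar (adelicForm F ι T'))) :
        ((ι → AdeleRing (𝓞 F) F) × (ι → AdeleRing (𝓞 F) F)) ≃ₗ[AdeleRing (𝓞 F) F]
          ((ι → AdeleRing (𝓞 F) F) × (ι → AdeleRing (𝓞 F) F))) =
      (adelicMpCont.proj F ι T p : symplecticGroup (polar (adelicForm F ι T))) := by
  subst h; rfl

/-- `Θ`-fixing is invariant. [cite: Weil1964, Chap. III n° 41 Thm 6 p. 193] -/
theorem mpCongr_mem_adelicMpTheta_iff (h : T = T') (p : adelicMpCont F ι T) :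
    ((mpCongr h p : adelicMpCont F ι T') : adelicMp F ι T') ∈ adelicMpTheta F ι T' ↔
      (p : adelicMp F ι T) ∈ adelicMpTheta F ι T := by
  subst h; exact Iff.rfl

omit [DecidableEq ι] in
/-- **complex conjugation commutes with re-indexing**: `C (R_e Ψ) = R_e (C Ψ)`. [cite: MoeglinVignerasWaldspurger1987, Chap. 2 II.1] -/
theorem piSchwartzBruhatConj_piSBReindex {ι' : Type} [Fintype ι'] (e : ι ≃ ι') (Ψ : piSchwartzBruhat F ι) :
    piSchwartzBruhatConj F ι' (piSBReindex F e Ψ) = piSBReindex F e (piSchwartzBruhatConj F ι Ψ) :=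
  Subtype.ext (funext fun w => by
    rw [coe_piSchwartzBruhatConj, Pi.star_apply, coe_piSBReindex_apply, coe_piSBReindex_apply, coe_piSchwartzBruhatConj,
      Pi.star_apply])

omit [DecidableEq ι] in
/-- and with the inverse re-indexing. [cite: MoeglinVignerasWaldspurger1987, Chap. 2 II.1] -/
theorem piSchwartzBruhatConj_piSBReindex_symm {ι' : Type} [Fintype ι'] [DecidableEq ι'] (e : ι ≃ ι') (Ψ : piSchwartzBruhat F ι') :
    piSchwartzBruhatConj F ι ((piSBReindex F e).symm Ψ) = (piSBReindex F e).symm (piSchwartzBruhatConj F ι' Ψ) := by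
  rw [piSBReindex_symm]
  exact piSchwartzBruhatConj_piSBReindex e.symm Ψ

end MpCongr

end Literature.NumberTheory.Weil1964

/-! ## §2 Sign identities: `U(−J) = U(J)`, `Gram(T_V, −T_W) = −Gram(T_V, T_W)` -/

namespace Literature.NumberTheory.Automorphic.UnitaryGroup

open Literature.NumberTheory.GelbartRogawski1991.GRConstruction (unitaryGroupOfForm_neg')

/-- `A ⊗ₖ (−B) = −(A ⊗ₖ B)`. [cite: Kudla1994, §2] -/
theorem kronecker_neg_right {R : Type*} [Ring R] {l m p q : Type*} (A : Matrix l m R) (B : Matrix p q R) :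
    A ⊗ₖ (-B) = -(A ⊗ₖ B) := by
  ext ⟨i, j⟩ ⟨i', j'⟩
  simp only [Matrix.kroneckerMap_apply, Matrix.neg_apply, mul_neg]

/-- `reindex e e (−A) = −reindex e e A`. [cite: Kudla1994, §2] -/
theorem reindex_neg {R : Type*} [Ring R] {l m : Type*} (e : l ≃ m) (A : Matrix l l R) :
    Matrix.reindex e e (-A) = -Matrix.reindex e e A :=
  Matrix.ext fun _ _ => rfl

section Neg

variable (F E : Type) [Field F] [NumberField F] [Field E] [NumberField E] [Algebra F E]
variable (c : E ≃ₐ[F] E) (N M : ℕ) (JV : Matrix (Fin N) (Fin N) E) (JW : Matrix (Fin M) (Fin M) E)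

/-- `(−J) ⊗ 1 = −(J ⊗ 1)` over the adèles. [cite: Kudla1994, §2] -/
theorem adelicForm_neg : adelicForm E M (-JW) = -adelicForm E M JW := by
  unfold adelicForm
  exact Matrix.map_neg _ (map_neg (algebraMap E (NumberField.AdeleRing (NumberField.RingOfIntegers E) E))) JW

/-- `(−J) ⊗ 1 = −(J ⊗ 1)` over the finite adèles. [cite: Kudla1994, §2] -/
theorem finiteAdelicForm_neg : finiteAdelicForm E M (-JW) = -finiteAdelicForm E M JW := by
  unfold finiteAdelicForm
  exact Matrix.map_neg _ (map_neg (algebraMap E (IsDedekindDomain.FiniteAdeleRing (NumberField.RingOfIntegers E) E))) JW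

omit [NumberField F] in
/-- **`U(−J_W)(𝔸_F) = U(J_W)(𝔸_F)`** as subgroups of `GL_M(𝔸_E)`. [cite: Kudla1994, §2; MoeglinVignerasWaldspurger1987, Ch. 1 I.17] -/
theorem adelic_neg : adelic F E c M (-JW) = adelic F E c M JW := by
  change unitaryGroupOfForm _ (adelicForm E M (-JW)) = unitaryGroupOfForm _ (adelicForm E M JW)
  rw [adelicForm_neg, unitaryGroupOfForm_neg']

omit [NumberField F] in
/-- **`U(−J_W)(𝔸_{F,f}) = U(J_W)(𝔸_{F,f})`** as subgroups of `GL_M(𝔸_E^∞)`. [cite: Kudla1994, §2; MoeglinVignerasWaldspurger1987, Ch. 1 I.17] -/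
theorem finAdelic_neg : finAdelic F E c M (-JW) = finAdelic F E c M JW := by
  change unitaryGroupOfForm _ (finiteAdelicForm E M (-JW)) = unitaryGroupOfForm _ (finiteAdelicForm E M JW)
  rw [finiteAdelicForm_neg, unitaryGroupOfForm_neg']

omit [NumberField F] in
/-- **`U(J_V ⊗ (−J_W))(𝔸_F) = U(J_V ⊗ J_W)(𝔸_F)`** as subgroups of `GL_{NM}(𝔸_E)`. [cite: Kudla1994, §2; MoeglinVignerasWaldspurger1987, Ch. 1 I.17] -/
theorem adelicPair_neg : adelicPair F E c N M JV (-JW) = adelicPair F E c N M JV JW := by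
  change unitaryGroupOfForm _ (adelicForm E N JV ⊗ₖ adelicForm E M (-JW)) =
    unitaryGroupOfForm _ (adelicForm E N JV ⊗ₖ adelicForm E M JW)
  rw [adelicForm_neg, kronecker_neg_right, unitaryGroupOfForm_neg']

/-- **`u ↦ ū : U(J_W)(𝔸_{F,f}) ≃* U(−J_W)(𝔸_{F,f})`**, the identity on matrices. [cite: Kudla1994, §2] -/
def finAdelicNeg : finAdelic F E c M JW ≃* finAdelic F E c M (-JW) :=
  MulEquiv.subgroupCongr (finAdelic_neg F E c M JW).symm

/-- the identity on the big group `U(J_V ⊗ J_W)(𝔸_F) ≃* U(J_V ⊗ (−J_W))(𝔸_F)`. [cite: Kudla1994, §2] -/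
def adelicPairNeg : adelicPair F E c N M JV JW ≃* adelicPair F E c N M JV (-JW) :=
  MulEquiv.subgroupCongr (adelicPair_neg F E c N M JV JW).symm

omit [NumberField F] in
/-- underlying matrix unchanged. [cite: Kudla1994, §2] -/
@[simp] theorem coe_finAdelicNeg (u : finAdelic F E c M JW) :
    ((finAdelicNeg F E c M JW u : finAdelic F E c M (-JW)) : GL (Fin M) (IsDedekindDomain.FiniteAdeleRing (NumberField.RingOfIntegers E) E)) = u :=
  MulEquiv.subgroupCongr_apply _ _

omit [NumberField F] in
/-- underlying matrix unchanged (inverse). [cite: Kudla1994, §2] -/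
@[simp] theorem coe_finAdelicNeg_symm (u : finAdelic F E c M (-JW)) :
    (((finAdelicNeg F E c M JW).symm u : finAdelic F E c M JW) : GL (Fin M) (IsDedekindDomain.FiniteAdeleRing (NumberField.RingOfIntegers E) E)) = u :=
  MulEquiv.subgroupCongr_symm_apply _ _

omit [NumberField F] in
/-- underlying matrix unchanged (big group, inverse). [cite: Kudla1994, §2] -/
@[simp] theorem coe_adelicPairNeg_symm (g : adelicPair F E c N M JV (-JW)) :
    (((adelicPairNeg F E c N M JV JW).symm g : adelicPair F E c N M JV JW) :
        GL (Fin N × Fin M) (NumberField.AdeleRing (NumberField.RingOfIntegers E) E)) = g :=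
  MulEquiv.subgroupCongr_symm_apply _ _

omit [NumberField F] in
/-- underlying matrix unchanged (big group). [cite: Kudla1994, §2] -/
@[simp] theorem coe_adelicPairNeg (g : adelicPair F E c N M JV JW) :
    ((adelicPairNeg F E c N M JV JW g : adelicPair F E c N M JV (-JW)) :
        GL (Fin N × Fin M) (NumberField.AdeleRing (NumberField.RingOfIntegers E) E)) = g :=
  MulEquiv.subgroupCongr_apply _ _

end Neg

end Literature.NumberTheory.Automorphic.UnitaryGroup

namespace HodgeCM.WeilCoinv

open Literature.NumberTheory.GelbartRogawski1991 Literature.NumberTheory.GelbartRogawski1991.UnitaryDualPair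
open Literature.NumberTheory.Automorphic Literature.NumberTheory.Weil1964
open Literature.RepresentationTheory.HeisenbergGroup
open NumberField NumberField.mixedEmbedding IsDedekindDomain

variable (F E : Type) [Field F] [NumberField F] [Field E] [NumberField E] [Algebra F E]
variable (c : E ≃ₐ[F] E) (N M : ℕ) {n : ℕ} (e : Fin N × Fin M ≃ Fin n)
variable (JV : Matrix (Fin N) (Fin N) E) (JW : Matrix (Fin M) (Fin M) E)
variable (TV : Matrix (Fin N) (Fin N) F) (TW : Matrix (Fin M) (Fin M) F)

/-- **`Gram(T_V, −T_W) = −Gram(T_V, T_W)`** over the adèles, enumerated by `e`. [cite: Kudla1994, §2] -/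
theorem adelicGram_neg : adelicGram F e TV (-TW) = -adelicGram F e TV TW := by
  change Matrix.reindex e e (TV.map (algebraMap F (AdeleRing (𝓞 F) F)) ⊗ₖ (-TW).map (algebraMap F (AdeleRing (𝓞 F) F))) =
    -Matrix.reindex e e (TV.map (algebraMap F (AdeleRing (𝓞 F) F)) ⊗ₖ TW.map (algebraMap F (AdeleRing (𝓞 F) F)))
  rw [Matrix.map_neg _ (map_neg (algebraMap F (AdeleRing (𝓞 F) F))), UnitaryGroup.kronecker_neg_right,
    UnitaryGroup.reindex_neg]

/-- the Kronecker currency: `T_V ⊗ (−T_W) = −(T_V ⊗ T_W)` over the adèles. [cite: Kudla1994, §2] -/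
theorem kronGram_neg :
    TV.map (algebraMap F (AdeleRing (𝓞 F) F)) ⊗ₖ (-TW).map (algebraMap F (AdeleRing (𝓞 F) F)) =
      -(TV.map (algebraMap F (AdeleRing (𝓞 F) F)) ⊗ₖ TW.map (algebraMap F (AdeleRing (𝓞 F) F))) := by
  rw [Matrix.map_neg _ (map_neg (algebraMap F (AdeleRing (𝓞 F) F))), UnitaryGroup.kronecker_neg_right]

/-! ## §3 The mirror splitting -/

variable {TV TW}

/-- **the MIRROR SPLITTING `s̄` of the pair `(V, W⁻)`**: `s̄(g) := (s(g))ᶜ` read in `Mp_ψ(W_{Gram(T_V, −T_W)})ᶜᵒⁿᵗ` along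
`U(J_V ⊗ (−J_W)) = U(J_V ⊗ J_W)` and `Gram(T_V, −T_W) = −Gram(T_V, T_W)`. [cite: Li1992, p. 181; Kudla1994, §1–§2] -/
def mirrorSplitting (s : UnitaryGroup.adelicPair F E c N M JV JW →* adelicMpCont F (Fin n) (adelicGram F e TV TW)) :
    UnitaryGroup.adelicPair F E c N M JV (-JW) →* adelicMpCont F (Fin n) (adelicGram F e TV (-TW)) :=
  (mpCongr (adelicGram_neg F N M e TV TW).symm).toMonoidHom.comp
    ((splittingConj s).comp (UnitaryGroup.adelicPairNeg F E c N M JV JW).symm.toMonoidHom)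

/-- unfolding. [cite: Li1992, p. 181] -/
theorem mirrorSplitting_apply (s : UnitaryGroup.adelicPair F E c N M JV JW →* adelicMpCont F (Fin n) (adelicGram F e TV TW))
    (g : UnitaryGroup.adelicPair F E c N M JV (-JW)) :
    mirrorSplitting F E c N M e JV JW s g =
      mpCongr (adelicGram_neg F N M e TV TW).symm
        (adelicMpContConj F (Fin n) (adelicGram F e TV TW) (s ((UnitaryGroup.adelicPairNeg F E c N M JV JW).symm g))) :=
  rfl

/-- on the image of the big group of `(V, W)`: `s̄ (g♭) = mpCongr ((s g)ᶜ)`. [cite: Li1992, p. 181] -/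
theorem mirrorSplitting_adelicPairNeg
    (s : UnitaryGroup.adelicPair F E c N M JV JW →* adelicMpCont F (Fin n) (adelicGram F e TV TW))
    (g : UnitaryGroup.adelicPair F E c N M JV JW) :
    mirrorSplitting F E c N M e JV JW s (UnitaryGroup.adelicPairNeg F E c N M JV JW g) =
      mpCongr (adelicGram_neg F N M e TV TW).symm (adelicMpContConj F (Fin n) (adelicGram F e TV TW) (s g)) :=
  (mirrorSplitting_apply F E c N M e JV JW s _).trans
    (congrArg (fun x => mpCongr (adelicGram_neg F N M e TV TW).symm (adelicMpContConj F (Fin n) (adelicGram F e TV TW) (s x)))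
      ((UnitaryGroup.adelicPairNeg F E c N M JV JW).symm_apply_apply g))

/-- **projection of the mirror splitting** in `GL(𝕎_𝔸)`: `π(s̄(g♭)) = π(s(g))`. [cite: MoeglinVignerasWaldspurger1987, Chap. 2 II.1 (B)] -/
theorem coe_proj_mirrorSplitting
    (s : UnitaryGroup.adelicPair F E c N M JV JW →* adelicMpCont F (Fin n) (adelicGram F e TV TW))
    (g : UnitaryGroup.adelicPair F E c N M JV JW) :
    ((adelicMpCont.proj F (Fin n) (adelicGram F e TV (-TW))
          (mirrorSplitting F E c N M e JV JW s (UnitaryGroup.adelicPairNeg F E c N M JV JW g)) :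
        symplecticGroup (polar (adelicForm F (Fin n) (adelicGram F e TV (-TW))))) :
        ((Fin n → AdeleRing (𝓞 F) F) × (Fin n → AdeleRing (𝓞 F) F)) ≃ₗ[AdeleRing (𝓞 F) F]
          ((Fin n → AdeleRing (𝓞 F) F) × (Fin n → AdeleRing (𝓞 F) F))) =
      (adelicMpCont.proj F (Fin n) (adelicGram F e TV TW) (s g) : symplecticGroup (polar (adelicForm F (Fin n) (adelicGram F e TV TW)))) :=
  (congrArg (fun q => ((adelicMpCont.proj F (Fin n) (adelicGram F e TV (-TW)) q :
      symplecticGroup (polar (adelicForm F (Fin n) (adelicGram F e TV (-TW))))) :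
        ((Fin n → AdeleRing (𝓞 F) F) × (Fin n → AdeleRing (𝓞 F) F)) ≃ₗ[AdeleRing (𝓞 F) F]
          ((Fin n → AdeleRing (𝓞 F) F) × (Fin n → AdeleRing (𝓞 F) F))))
    (mirrorSplitting_adelicPairNeg F E c N M e JV JW s g)).trans
    ((adelicMpCont.coe_proj_mpCongr _ _).trans (coe_proj_adelicMpContConj (s g)))

/-! ### §3b The projection half of `IsCompatible s̄` -/

section ProjHalf

variable [Algebra.IsQuadraticExtension F E] {δ : E} (hcδ : c δ = -δ) (hδ : δ ≠ 0) {d : F}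
  (hd : δ * δ = algebraMap F E d) (hV : TV.IsSymm)

/-- pointwise formula for the datum's `toSp` (restriction of scalars, re-indexed): one-sided unfolding.
[cite: GelbartRogawski1991, §3.1 p. 454] -/
theorem coe_toSp_apply (hW : TW.IsSymm) (hJV : JV = TV.map (algebraMap F E)) (hJW : JW = TW.map (algebraMap F E))
    (g : UnitaryGroup.adelicPair F E c N M JV JW) (v : (Fin n → AdeleRing (𝓞 F) F) × (Fin n → AdeleRing (𝓞 F) F)) :
    ((toSp F E c N M e JV JW hcδ hδ hd hV hW hJV hJW g :
        symplecticGroup (polar (adelicForm F (Fin n) (adelicGram F e TV TW)))) :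
        ((Fin n → AdeleRing (𝓞 F) F) × (Fin n → AdeleRing (𝓞 F) F)) ≃ₗ[AdeleRing (𝓞 F) F]
          ((Fin n → AdeleRing (𝓞 F) F) × (Fin n → AdeleRing (𝓞 F) F))) v =
      UnitaryGroup.reindexW (AdeleRing (𝓞 F) F) e
        ((UnitaryGroup.isQuadraticCoordinates_adele E c hcδ hδ hd).resAut (Fin N × Fin M)
          (g : GL (Fin N × Fin M) (AdeleRing (𝓞 E) E))
          ((UnitaryGroup.reindexW (AdeleRing (𝓞 F) F) e).symm v)) :=
  rfl

/-- **the projection half of `IsCompatible s̄`**: if `π ∘ s = ι` (first conjunct of `IsCompatible s` for the datum of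
`(V, W)`), then `π ∘ s̄ = ι′` for the datum of `(V, W⁻)`. [cite: GelbartRogawski1991, §3.1 Prop. 3.1.1 p. 455; Kudla1994, §2] -/
theorem proj_mirrorSplitting_eq_toSp (hW : TW.IsSymm) (hVd : IsUnit TV.det) (hWd : IsUnit TW.det)
    (hJV : JV = TV.map (algebraMap F E)) (hJW : JW = TW.map (algebraMap F E))
    {s : UnitaryGroup.adelicPair F E c N M JV JW →* adelicMpCont F (Fin n) (adelicGram F e TV TW)}
    (hs : (splittingDatum F E c N M e JV JW hcδ hδ hd hV hW hVd hWd hJV hJW).IsCompatible s)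
    (hW' : (-TW).IsSymm) (hJW' : -JW = (-TW).map (algebraMap F E))
    (g' : UnitaryGroup.adelicPair F E c N M JV (-JW)) :
    adelicMpCont.proj F (Fin n) (adelicGram F e TV (-TW)) (mirrorSplitting F E c N M e JV JW s g') =
      toSp F E c N M e JV (-JW) hcδ hδ hd hV hW' hJV hJW' g' := by
  have h1 := hs.1 ((UnitaryGroup.adelicPairNeg F E c N M JV JW).symm g')
  apply Subtype.ext
  apply LinearEquiv.ext
  intro v
  -- `π(s̄ g') = π(s g)` in `GL(𝕎_𝔸)`, `g := g'` read in `U(J_V ⊗ J_W)`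
  have eL := LinearEquiv.congr_fun
    ((congrArg (fun q => ((adelicMpCont.proj F (Fin n) (adelicGram F e TV (-TW)) q :
        symplecticGroup (polar (adelicForm F (Fin n) (adelicGram F e TV (-TW))))) :
          ((Fin n → AdeleRing (𝓞 F) F) × (Fin n → AdeleRing (𝓞 F) F)) ≃ₗ[AdeleRing (𝓞 F) F]
            ((Fin n → AdeleRing (𝓞 F) F) × (Fin n → AdeleRing (𝓞 F) F))))
      (mirrorSplitting_apply F E c N M e JV JW s g')).trans
      ((adelicMpCont.coe_proj_mpCongr _ _).trans (coe_proj_adelicMpContConj _))) v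
  -- `π(s g) = ι(g)` (compatibility of `s`)
  have eM := LinearEquiv.congr_fun
    (congrArg (fun q : symplecticGroup (polar (adelicForm F (Fin n) (adelicGram F e TV TW))) =>
      (q : ((Fin n → AdeleRing (𝓞 F) F) × (Fin n → AdeleRing (𝓞 F) F)) ≃ₗ[AdeleRing (𝓞 F) F]
        ((Fin n → AdeleRing (𝓞 F) F) × (Fin n → AdeleRing (𝓞 F) F)))) h1) v
  refine eL.trans (eM.trans ?_)
  show ((toSp F E c N M e JV JW hcδ hδ hd hV hW hJV hJW ((UnitaryGroup.adelicPairNeg F E c N M JV JW).symm g') :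
      symplecticGroup (polar (adelicForm F (Fin n) (adelicGram F e TV TW)))) :
      ((Fin n → AdeleRing (𝓞 F) F) × (Fin n → AdeleRing (𝓞 F) F)) ≃ₗ[AdeleRing (𝓞 F) F]
        ((Fin n → AdeleRing (𝓞 F) F) × (Fin n → AdeleRing (𝓞 F) F))) v = _
  rw [coe_toSp_apply, coe_toSp_apply, UnitaryGroup.coe_adelicPairNeg_symm]

/-- **`IsCompatible s̄` from its two halves**: the projection half (above) and the RATIONAL half
`s̄(G₁′(F)) ⊆ r_{Gram′}(Sp_F)` (adapt-2's Θ-rigidity transport `conj r_T(γ) = r_{−T}(γ♭)`, taken here as the hypothesis `hrat`).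
[cite: GelbartRogawski1991, §3.1 Prop. 3.1.1 p. 455 L1–3; Remark p. 457 L4] -/
theorem isCompatible_mirrorSplitting (hW : TW.IsSymm) (hVd : IsUnit TV.det) (hWd : IsUnit TW.det)
    (hJV : JV = TV.map (algebraMap F E)) (hJW : JW = TW.map (algebraMap F E))
    {s : UnitaryGroup.adelicPair F E c N M JV JW →* adelicMpCont F (Fin n) (adelicGram F e TV TW)}
    (hs : (splittingDatum F E c N M e JV JW hcδ hδ hd hV hW hVd hWd hJV hJW).IsCompatible s)
    (hW' : (-TW).IsSymm) (hWd' : IsUnit (-TW).det) (hJW' : -JW = (-TW).map (algebraMap F E))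
    (hrat : ∀ γ ∈ (UnitaryGroup.rationalPairToAdelic F E c N M JV (-JW)).range,
      mirrorSplitting F E c N M e JV JW s γ ∈
        (ratSection F (adelicGram F e TV (-TW)) (isUnit_det_adelicGram F e hVd hWd')).range) :
    (splittingDatum F E c N M e JV (-JW) hcδ hδ hd hV hW' hVd hWd' hJV hJW').IsCompatible
      (mirrorSplitting F E c N M e JV JW s) :=
  ⟨fun g' => proj_mirrorSplitting_eq_toSp F E c N M e JV JW hcδ hδ hd hV hW hVd hWd hJV hJW hs hW' hJW' g', hrat⟩

end ProjHalf

end HodgeCM.WeilCoinv
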